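import Mathlib
import Summits.NavierStokesRegularity.NavierStokesRegularity.Theorems.EulerZoomLiouvillePowerGaugeEulerLiouvilleNeedleExitAnomalous

/-!
# FIRST HIT OF A PLANE — a backward similarity orbit crosses the plane `⟪y, e⟫ = s` for the first time only where
# `⟪V y, e⟫ ≤ −γ s` (plate t42a-PLANAR, nsreg-p2 g33's RULING 16:58:39Z (2); ROUND-42 «THE CONDENSER», planar step (B1))

Width piece for crux `EulerZoomLiouville.PowerGaugeEulerLiouville` (stmt-NavierStokesRegularity-19832), by name under
LEAD 19832 (ns-typeII-p2 g12); seat ns-in-ser-c g3 (director-ns inputs-36), `--supports stmt-NavierStokesRegularity-19832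
--as helper`.  Planar twin of t42a `…NeedleExitAnomalous` (spheres `‖·‖ = t` ↦ planes `⟪·, e⟫ = s`; the same left-slope and
first-hitting-time arguments with the linear functional `⟪·, e⟫` in place of `‖·‖²`).  Backward similarity flow `Ψ_σ y = Φ_{−σ} y`
of `W = γy + V` (`Ψ' = −W(Ψ)`), `V ∈ C¹` with bounded derivative; pure ODE kinematics, no Euler equation:

* `hasDerivAt_inner_flow_neg` — `d/dσ ⟪Ψ_σ y, e⟫ = −⟪W(Ψ_σ y), e⟫`;
* `inner_transport_nonpos_of_firstHit_plane` — if `⟪Ψ_σ y, e⟫ < s` on `[0, σ₁)` and `⟪Ψ_{σ₁} y, e⟫ = s` (`σ₁ > 0`) then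
  `⟪W(Ψ_{σ₁} y), e⟫ ≤ 0`;
* `inner_le_neg_mul_of_firstHit_plane`, `mul_le_norm_of_firstHit_plane` — hence `⟪V y₁, e⟫ ≤ −γs` and, for a unit normal,
  `γ s ≤ ‖V y₁‖` at the first hitting point `y₁`: THE EXIT POINT THROUGH A PLANE IS ANOMALOUS;
* `exists_firstHit_plane_of_exit` — an orbit with `⟪y, e⟫ < s ≤ ⟪Ψ_L y, e⟫` has a first hitting time `σ₁ ∈ (0, L]`;
* `exists_anomalous_plane_of_exit` — the package.

READING (ROUND-42 v1.0 §1 «PLANES, NOT SPHERES»): with the flat Fubini slicing (t42-QP) one QUIET plane `s ∈ [R, 2R]` carries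
small `A`/`E`-gauge mass; every orbit leaving the slab must hit it anomalously, and the planar length–area lemma (t42-LA) prices
the crossing.  HONEST FRAMING: kinematics for THE ONE STATEMENT; proves nothing about the crux E (19832 OPEN), any door Target,
or Navier–Stokes regularity; no summit statement is touched. [folklore]
-/

noncomputable section

set_option linter.dupNamespace false

open Set Metric Filter Topology Function InnerProductSpace
open scoped RealInnerProductSpace

namespace Summit.NavierStokesRegularity.NavierStokesRegularity.Theorems.PowerGaugeEulerLiouville.Condenser

open Literature.Analysis Literature.Analysis.FluidPDE
open Summit.NavierStokesRegularity.NavierStokesRegularity.Theorems.PowerGaugeEulerLiouville.C2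

variable {γ : ℝ} {V : (EuclideanSpace ℝ (Fin 3)) → (EuclideanSpace ℝ (Fin 3))}

/-- `d/dσ ⟪Ψ_σ y, e⟫ = −⟪W(Ψ_σ y), e⟫` along the backward similarity flow. [folklore] -/
theorem hasDerivAt_inner_flow_neg (hV : ContDiff ℝ 1 V) {K : ℝ} (hK : ∀ y, ‖fderiv ℝ V y‖ ≤ K)
    (y e : EuclideanSpace ℝ (Fin 3)) (r : ℝ) :
    HasDerivAt (fun s => ⟪ODE.evolutionMap (fun _ : ℝ => selfSimilarTransport γ 0 V) 0 (-s) y, e⟫)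
      (-⟪selfSimilarTransport γ 0 V (ODE.evolutionMap (fun _ : ℝ => selfSimilarTransport γ 0 V) 0 (-r) y), e⟫) r := by
  have h := (Kelvin.hasDerivAt_flow_neg (γ := γ) hV hK y r).inner ℝ (hasDerivAt_const r e)
  simp only [inner_zero_right, zero_add, real_inner_smul_left, neg_mul, one_mul] at h
  exact h

/-- **First hitting of a plane ⇒ crossing outward.**  If `⟪Ψ_σ y, e⟫ < s` for `σ ∈ [0, σ₁)` and `⟪Ψ_{σ₁} y, e⟫ = s` with
`σ₁ > 0`, then `⟪W(Ψ_{σ₁} y), e⟫ ≤ 0` (the left difference quotients of `⟪Ψ_σ y, e⟫` at `σ₁` are non-negative). [folklore] -/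
theorem inner_transport_nonpos_of_firstHit_plane (hV : ContDiff ℝ 1 V) {K : ℝ} (hK : ∀ y, ‖fderiv ℝ V y‖ ≤ K)
    {y e : EuclideanSpace ℝ (Fin 3)} {s σ₁ : ℝ} (hσ₁ : 0 < σ₁)
    (hlt : ∀ σ ∈ Ico (0 : ℝ) σ₁, ⟪ODE.evolutionMap (fun _ : ℝ => selfSimilarTransport γ 0 V) 0 (-σ) y, e⟫ < s)
    (heq : ⟪ODE.evolutionMap (fun _ : ℝ => selfSimilarTransport γ 0 V) 0 (-σ₁) y, e⟫ = s) :
    ⟪selfSimilarTransport γ 0 V (ODE.evolutionMap (fun _ : ℝ => selfSimilarTransport γ 0 V) 0 (-σ₁) y), e⟫ ≤ 0 := by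
  set g : ℝ → ℝ := fun σ => ⟪ODE.evolutionMap (fun _ : ℝ => selfSimilarTransport γ 0 V) 0 (-σ) y, e⟫ with hg
  set I : ℝ := ⟪selfSimilarTransport γ 0 V (ODE.evolutionMap (fun _ : ℝ => selfSimilarTransport γ 0 V) 0 (-σ₁) y), e⟫
    with hI
  have hder : HasDerivAt g (-I) σ₁ := hasDerivAt_inner_flow_neg hV hK y e σ₁
  -- the derivative is the limit of the slopes from the left
  have hwithin : HasDerivWithinAt g (-I) (Iio σ₁) σ₁ := hder.hasDerivWithinAt
  have hset : Iio σ₁ \ {σ₁} = Iio σ₁ := by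
    ext x
    simp only [Set.mem_sdiff, mem_Iio, mem_singleton_iff]
    exact ⟨fun h => h.1, fun h => ⟨h, h.ne⟩⟩
  rw [hasDerivWithinAt_iff_tendsto_slope, hset] at hwithin
  -- slopes from the left (within `(0, σ₁)`) are non-negative
  have hev : ∀ᶠ σ in 𝓝[Iio σ₁] σ₁, 0 ≤ slope g σ₁ σ := by
    filter_upwards [Ioo_mem_nhdsLT hσ₁] with σ hσ
    rw [slope_def_field]
    have hgs : g σ < g σ₁ := by
      simp only [hg, heq]
      exact hlt σ ⟨hσ.1.le, hσ.2⟩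
    have hden : σ - σ₁ < 0 := by linarith [hσ.2]
    exact (div_pos_of_neg_of_neg (by linarith) hden).le
  have h0 : 0 ≤ -I := ge_of_tendsto hwithin hev
  linarith

/-- **THE EXIT POINT THROUGH A PLANE IS ANOMALOUS (normal-velocity form).**  At a first hitting point `y₁ = Ψ_{σ₁} y` of the
plane `⟪·, e⟫ = s`:  `⟪V y₁, e⟫ ≤ −γ s`. [folklore] -/
theorem inner_le_neg_mul_of_firstHit_plane (hV : ContDiff ℝ 1 V) {K : ℝ} (hK : ∀ y, ‖fderiv ℝ V y‖ ≤ K)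
    {y e : EuclideanSpace ℝ (Fin 3)} {s σ₁ : ℝ} (hσ₁ : 0 < σ₁)
    (hlt : ∀ σ ∈ Ico (0 : ℝ) σ₁, ⟪ODE.evolutionMap (fun _ : ℝ => selfSimilarTransport γ 0 V) 0 (-σ) y, e⟫ < s)
    (heq : ⟪ODE.evolutionMap (fun _ : ℝ => selfSimilarTransport γ 0 V) 0 (-σ₁) y, e⟫ = s) :
    ⟪V (ODE.evolutionMap (fun _ : ℝ => selfSimilarTransport γ 0 V) 0 (-σ₁) y), e⟫ ≤ -(γ * s) := by
  have h := inner_transport_nonpos_of_firstHit_plane hV hK hσ₁ hlt heq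
  rw [selfSimilarTransport_apply, sub_zero, inner_add_left, real_inner_smul_left, heq] at h
  linarith

/-- **THE EXIT POINT THROUGH A PLANE IS ANOMALOUS (size form).**  At a first hitting point `y₁` of the plane `⟪·, e⟫ = s`
with unit normal `e`:  `γ s ≤ ‖V y₁‖` — for `s > 0` the profile velocity is at least the similarity drift across the plane
there. [folklore] -/
theorem mul_le_norm_of_firstHit_plane (hV : ContDiff ℝ 1 V) {K : ℝ} (hK : ∀ y, ‖fderiv ℝ V y‖ ≤ K)
    {y e : EuclideanSpace ℝ (Fin 3)} (he : ‖e‖ = 1) {s σ₁ : ℝ} (hσ₁ : 0 < σ₁)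
    (hlt : ∀ σ ∈ Ico (0 : ℝ) σ₁, ⟪ODE.evolutionMap (fun _ : ℝ => selfSimilarTransport γ 0 V) 0 (-σ) y, e⟫ < s)
    (heq : ⟪ODE.evolutionMap (fun _ : ℝ => selfSimilarTransport γ 0 V) 0 (-σ₁) y, e⟫ = s) :
    γ * s ≤ ‖V (ODE.evolutionMap (fun _ : ℝ => selfSimilarTransport γ 0 V) 0 (-σ₁) y)‖ := by
  have h := inner_le_neg_mul_of_firstHit_plane hV hK hσ₁ hlt heq
  set y₁ := ODE.evolutionMap (fun _ : ℝ => selfSimilarTransport γ 0 V) 0 (-σ₁) y with hy₁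
  have hcs : |⟪V y₁, e⟫| ≤ ‖V y₁‖ * ‖e‖ := abs_real_inner_le_norm (V y₁) e
  rw [he, mul_one] at hcs
  have := neg_abs_le ⟪V y₁, e⟫
  linarith

/-- **First hitting times of a plane exist.**  If `⟪y, e⟫ < s ≤ ⟪Ψ_L y, e⟫` with `L ≥ 0`, there is a first time
`σ₁ ∈ (0, L]` at which the orbit reaches the plane `⟪·, e⟫ = s`: `⟪Ψ_σ y, e⟫ < s` on `[0, σ₁)` and `⟪Ψ_{σ₁} y, e⟫ = s`.
[folklore] -/
theorem exists_firstHit_plane_of_exit (hV : ContDiff ℝ 1 V) {K : ℝ} (hK : ∀ y, ‖fderiv ℝ V y‖ ≤ K)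
    {y e : EuclideanSpace ℝ (Fin 3)} {s L : ℝ} (hL : 0 ≤ L) (hy : ⟪y, e⟫ < s)
    (hexit : s ≤ ⟪ODE.evolutionMap (fun _ : ℝ => selfSimilarTransport γ 0 V) 0 (-L) y, e⟫) :
    ∃ σ₁ ∈ Ioc (0 : ℝ) L,
      (∀ σ ∈ Ico (0 : ℝ) σ₁, ⟪ODE.evolutionMap (fun _ : ℝ => selfSimilarTransport γ 0 V) 0 (-σ) y, e⟫ < s) ∧
        ⟪ODE.evolutionMap (fun _ : ℝ => selfSimilarTransport γ 0 V) 0 (-σ₁) y, e⟫ = s := by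
  set f : ℝ → ℝ := fun σ => ⟪ODE.evolutionMap (fun _ : ℝ => selfSimilarTransport γ 0 V) 0 (-σ) y, e⟫ with hf
  have hfc : Continuous f := by
    have hc : Continuous fun σ : ℝ => ODE.evolutionMap (fun _ : ℝ => selfSimilarTransport γ 0 V) 0 (-σ) y :=
      continuous_iff_continuousAt.2 fun σ => (Kelvin.hasDerivAt_flow_neg (γ := γ) hV hK y σ).continuousAt
    exact hc.inner continuous_const
  have hf0 : f 0 = ⟪y, e⟫ := by simp [hf, ODE.evolutionMap_self]
  set S : Set ℝ := Icc 0 L ∩ {σ | s ≤ f σ} with hS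
  have hSc : IsClosed S := isClosed_Icc.inter (isClosed_le continuous_const hfc)
  have hLS : L ∈ S := ⟨⟨hL, le_rfl⟩, hexit⟩
  have hSne : S.Nonempty := ⟨L, hLS⟩
  have hSbdd : BddBelow S := ⟨0, fun σ hσ => hσ.1.1⟩
  set σ₁ := sInf S with hσ₁
  have hσ₁S : σ₁ ∈ S := hSc.csInf_mem hSne hSbdd
  have hσ₁L : σ₁ ≤ L := csInf_le hSbdd hLS
  have hσ₁0 : 0 ≤ σ₁ := hσ₁S.1.1
  -- below `σ₁` the orbit is strictly on the near side
  have hbelow : ∀ σ ∈ Ico (0 : ℝ) σ₁, f σ < s := by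
    intro σ hσ
    by_contra hge
    have hσS : σ ∈ S := ⟨⟨hσ.1, hσ.2.le.trans hσ₁L⟩, not_lt.1 hge⟩
    exact absurd (csInf_le hSbdd hσS) (not_le.2 hσ.2)
  have hpos : 0 < σ₁ := by
    rcases hσ₁0.eq_or_lt with h | h
    · exfalso
      have := hσ₁S.2
      simp only [mem_setOf_eq, ← h, hf0] at this
      linarith
    · exact h
  -- at `σ₁` the functional is exactly `s`: `≥` from `σ₁ ∈ S`, `≤` by continuity from the left
  have hle : f σ₁ ≤ s := by
    have htend : Tendsto f (𝓝[<] σ₁) (𝓝 (f σ₁)) := (hfc.tendsto σ₁).mono_left nhdsWithin_le_nhds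
    have hev : ∀ᶠ σ in 𝓝[<] σ₁, f σ ≤ s := by
      filter_upwards [Ioo_mem_nhdsLT hpos] with σ hσ
      exact (hbelow σ ⟨hσ.1.le, hσ.2⟩).le
    exact le_of_tendsto htend hev
  exact ⟨σ₁, ⟨hpos, hσ₁L⟩, hbelow, le_antisymm hle hσ₁S.2⟩

/-- **EVERY EXIT THROUGH A PLANE PRODUCES AN ANOMALOUS POINT ON IT.**  If a backward similarity orbit goes from
`⟪y, e⟫ < s` to `⟪Ψ_L y, e⟫ ≥ s` (`L ≥ 0`, `e` a unit normal), then at its first hitting point `y₁ = Ψ_{σ₁} y` of the plane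
`⟪·, e⟫ = s` (`σ₁ ∈ (0, L]`):  `⟪V y₁, e⟫ ≤ −γs` and `γ s ≤ ‖V y₁‖`.  (Planar step (B1) of THEOREM B, ROUND-42: applied to the
quiet plane `s ∈ [R, 2R]` for an orbit leaving the slab.) [folklore] -/
theorem exists_anomalous_plane_of_exit (hV : ContDiff ℝ 1 V) {K : ℝ} (hK : ∀ y, ‖fderiv ℝ V y‖ ≤ K)
    {y e : EuclideanSpace ℝ (Fin 3)} (he : ‖e‖ = 1) {s L : ℝ} (hL : 0 ≤ L) (hy : ⟪y, e⟫ < s)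
    (hexit : s ≤ ⟪ODE.evolutionMap (fun _ : ℝ => selfSimilarTransport γ 0 V) 0 (-L) y, e⟫) :
    ∃ σ₁ ∈ Ioc (0 : ℝ) L,
      ⟪ODE.evolutionMap (fun _ : ℝ => selfSimilarTransport γ 0 V) 0 (-σ₁) y, e⟫ = s ∧
      ⟪V (ODE.evolutionMap (fun _ : ℝ => selfSimilarTransport γ 0 V) 0 (-σ₁) y), e⟫ ≤ -(γ * s) ∧
      γ * s ≤ ‖V (ODE.evolutionMap (fun _ : ℝ => selfSimilarTransport γ 0 V) 0 (-σ₁) y)‖ := by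
  obtain ⟨σ₁, hσ₁, hlt, heq⟩ := exists_firstHit_plane_of_exit hV hK hL hy hexit
  exact ⟨σ₁, hσ₁, heq, inner_le_neg_mul_of_firstHit_plane hV hK hσ₁.1 hlt heq,
    mul_le_norm_of_firstHit_plane hV hK he hσ₁.1 hlt heq⟩

end Summit.NavierStokesRegularity.NavierStokesRegularity.Theorems.PowerGaugeEulerLiouville.Condenser
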